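import Literature.MathematicalPhysics.QuantumFieldTheory.BalabanImbrieJaffe1984to88.BIJ88Expect32WellDefined

/-!
# `BalabanImbrieJaffe1984to88.BIJ85Integral14` — T. Bałaban, J. Imbrie, A. Jaffe, *Renormalization of the Higgs model: minimizers,
propagators and the stability of mean field theory*, Commun. Math. Phys. **97** (1985) 299–329 [BalabanImbrieJaffe1985], **(1.4)** p. 301:
the normalized integrals `∫ψe^{−S(u,φ)}𝒟u𝒟φ / ∫e^{−S(u,φ)}𝒟u𝒟φ` of the unit-lattice abelian Higgs model with the action **(1.1)**, TYPED as a
definition with body on the integrating carrier of record of the cell, and shown WELL DEFINED (denominator `≠ 0`) and gauge invariant.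

statement-level skeleton of published theorems with citation tags; proofs where landed; nothing here is a claim about the Yang–Mills mass gap

PDF held: `paper:balaban1985-cmp97-bij-higgs-minimizers` (journal page = PDF page + 298); p. 301 [PDF 3] read on the text layer
(`lit read … --pages 3`) and on the render `HOME/lit-balaban-r15/pages/1985-cmp97-bij-higgs-minimizers-p003-x2.png` of the r15 seat.

CITATION HEADER (lean-in-tree rule).  Part of the lit-balaban TYPED SKELETON (HOME `run/shared/lean/pub/lit-balaban/`), unit `lit-balaban-r15`
gen 11 (reader/typer and fold owner of C1 = [BalabanImbrieJaffe1985]).  Serves row `C1.Eq1.4` of `HOME/lit-balaban-r15/ROWS-C1.md` (until now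
«absent (normalized-expectation display + programme prose; no statement)»): the DISPLAY (1.4) is typed here; the programme prose of p. 301
around it (steepest descent, the quadratic actions `S_Q`, uniform stability bounds) stays prose — its located members are rows `C1.Thm7.1.1`,
`C1.Eq4.6.2-4.6.4`, `C1.Eq7.3.1-7.3.2`.

THE PRINTED TEXT (p. 301 [PDF 3], verbatim).  *"The basic strategy to gain control over the spectrum is to establish exponential decay of gauge
invariant correlations. We develop a method of steepest descent to study integrals of the form ∫ψe^{−S(u,φ)} / ∫e^{−S(u,φ)}, (1.4) where ψ is a
gauge invariant functional of u and φ."*  Here `S(u, φ)` is the unit-lattice action (1.1)–(1.2) p. 300 (`BIJ85Sect1Model.action`, r15) on the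
periodic lattice (p. 302: *"T_a denoting the a-lattice with periodic (toroidal) boundary conditions"*).

CARRIER (ruling G.5-1/S2 of the cell: everything that INTEGRATES lives on ONE carrier).  The unit lattice is the torus of record
`Balaban1983to89.Site P j`; the gauge field is integrated as `U : GaugeField P j U1` (`U1 = Matrix.unitaryGroup (Fin 1) ℂ` of
`BIJ88Sect3Statements`) against the product Haar probability measure `𝒟u = fieldMeasure P j U1`, the scalar field `φ : HiggsField P j = Site P j → ℂ`
against Lebesgue measure `𝒟φ`; C1's own bond variables `u : PBond P j → Circle` (the carrier of (1.1)) are READ from `U` through the cell's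
group isomorphism `BIJ88Sect3Rescaling.circleEquivU1 : Circle ≃* U1` (`toU1Field`).  With this reading, (1.4) IS the quotient
`BIJ88Sect3Statements.expect S ψ = [ψ]/[1]` of the companion paper [BalabanImbrieJaffe1988] (1.3)/(3.1)–(3.2) (r18's objects of record) taken at
the action `S = (1.1)`; no second expectation functional is introduced.

WHAT IS TYPED / PROVED (0 `sorry`; definitions with bodies and theorems only — no `Prop`-valued fact; standard axioms).
* §1 `toU1Field` (C1's `u` read from the carrier of record; `coe_toU1Field` : its value in `ℂ` is r18's `cfg U`), and the BRIDGE between the two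
  typings of the same lattice action: **`action_eq_action88`** — C1's (1.1) `S(u, φ)` with couplings `e(ε)`, `λ(ε)`, `μ² = (m² + δm²)ε²`, `E` EQUALS
  C2's (3.3) `BIJ88Sect3Statements.action` at unit weights `w = c = 1`, charge `e(ε)`, quartic coupling `λ(ε)`, mass shift `δm² := (μ² − 1)/2` and
  constant `E₀ := E − |T|/(64λ(ε))`, `E₁ := 0` (the two printed potentials (1.2) `λ|ξ|⁴ − ¼μ²|ξ|²` and C2 (3.4) `λ|φ|⁴ − ¼|φ|² + 1/(64λ) − ½δm²|φ|²`
  differ by this re-labelling and a constant), `selfInt_eq_higgsP`, `plaq_coe`, `covDeriv_eq_covD`, `action_toU1Field` (`= actionU1 1 1 …`).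
* §2 **(1.4)**: `S11` (the action (1.1) as a function of the configuration of record) and **`integral14 e(ε) λ(ε) μ² E ψ`** `:= expect (S11 …) ψ`;
  `integral14_eq_div` (the printed quotient of the two integrals, verbatim), `integral14_eq_expect88` (= C2's `⟨·⟩` at the re-labelled couplings).
* §3 WELL-DEFINEDNESS, by r18's `BIJ88Expect32WellDefined` at `ε = 1`: for `λ(ε) > 0` (every `e(ε)`, `μ²`, `E`, every torus)
  **`den_ne_zero`** (`∫e^{−S}𝒟u𝒟φ ≠ 0` — the partition function is a positive real: `re_den_pos`, `im_den`), **`integral14_one`** (`ψ ≡ 1 ↦ 1`),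
  `integral14_const`.
* §4 GAUGE INVARIANCE (the words *"gauge invariant functional"*): `GaugeInvariant ψ` (C1 (2.7): `ψ(u^h, φ^h) = ψ(u, φ)` for all `h : T → U(1)`),
  `gaugeInvariant_boltzmann` (the weight `e^{−S}` is one, by r15's `action_gauge`), `toU1Field_gaugeAct` / `gaugeHiggs_eq` (C1's (2.7) and the
  tree's `GaugeField.gaugeAct` agree under the reading), and **`integral14_gauge`**: `⟨ψ^h⟩ = ⟨ψ⟩` for EVERY functional `ψ` and every `h`
  (r18's `expect_gaugeAct` through the bridge) — so restricting (1.4) to gauge invariant `ψ` loses no expectation value.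
HONEST SCOPE.  Only the object (1.4) and its elementary properties; nothing of the steepest-descent programme, no decay of correlations, no
mass gap (p. 301: *"In other papers we estimate the corrections due to large fields"*).  Imports: Literature + Mathlib only.
-/

namespace Literature.MathematicalPhysics.QuantumFieldTheory.BalabanImbrieJaffe1984to88.BIJ85Integral14

open Literature.MathematicalPhysics.QuantumFieldTheory.Balaban1983to89
open BIJ88Sect3Statements (U1 toC cfg bracket expect actionU1 covD plaqVar higgsP)
open BIJ88Sect3Rescaling (circleEquivU1 coe_circleEquivU1_symm)
open BIJ85Sect1Model (U1Field HiggsField plaq covDeriv selfInt gaugeU gaugeHiggs)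
open BIJ88Expect32WellDefined (bracket_one_ne_zero re_bracket_one_pos im_bracket_one expect_one expect_const expect_gaugeAct)
open scoped BigOperators ComplexConjugate
open _root_.MeasureTheory Complex

noncomputable section

variable {P : Params} {j : ℕ}

/-! ## §1 Reading C1's bond variables from the carrier of record; the bridge (1.1) = C2 (3.3) -/

/-- C1's `U(1)` bond field `u : bonds → U(1)` of (1.1) (typed over Mathlib's `Circle`, `BIJ85Sect1Model.U1Field`) READ FROM a configuration
`U : GaugeField P j U1` of the integrating carrier of record, bond by bond through `circleEquivU1⁻¹`. [cite: BalabanImbrieJaffe1985, (1.4) p.301] -/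
def toU1Field (U : GaugeField P j U1) : U1Field P j := fun b => circleEquivU1.symm (U b)

/-- kernel: the complex value of the read bond variable is r18's `cfg U b = toC (U b)`. [cite: BalabanImbrieJaffe1985, (1.4) p.301] -/
@[simp] theorem coe_toU1Field (U : GaugeField P j U1) (b : PBond P j) : ((toU1Field U b : Circle) : ℂ) = cfg U b :=
  coe_circleEquivU1_symm (U b)

/-- kernel: as a `ℂ`-valued bond field, `toU1Field U` is `cfg U`. [cite: BalabanImbrieJaffe1985, (1.4) p.301] -/
theorem coe_toU1Field_eq_cfg (U : GaugeField P j U1) : (fun b => ((toU1Field U b : Circle) : ℂ)) = cfg U := by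
  funext b; exact coe_toU1Field U b

/-- kernel: C1's plaquette variable `u(p)` (1.1), read in `ℂ`, is C2's `plaqVar` of the `ℂ`-valued bond field (`u_b⁻¹ = ū_b` on the circle).
[cite: BalabanImbrieJaffe1985, (1.1) p.300] -/
theorem plaq_coe (u : U1Field P j) (p : Balaban1983to89.Plaq P j) : ((plaq u p : Circle) : ℂ) = plaqVar (fun b => (u b : ℂ)) p := by
  simp only [plaq, plaqVar, Circle.coe_mul, Circle.coe_inv_eq_conj]

/-- kernel: C1's covariant derivative `(D_uφ)_b = u_bφ_{b₊} − φ_{b₋}` (1.1) is C2's `covD` at `c = ε⁻¹ = 1`. [cite: BalabanImbrieJaffe1985, (1.1) p.300] -/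
theorem covDeriv_eq_covD (u : U1Field P j) (φ : HiggsField P j) (b : PBond P j) :
    covDeriv u φ b = covD 1 (fun b => (u b : ℂ)) φ b := by
  simp [covDeriv, covD]

/-- kernel: the potential (1.2) `P(ξ) = λ(ε)|ξ|⁴ − ¼μ²|ξ|²` is C2's (3.4) `λ|ξ|⁴ − ¼|ξ|² + 1/(64λ) − ½δm²|ξ|²` at `δm² := (μ² − 1)/2`, minus the
constant `1/(64λ(ε))`. [cite: BalabanImbrieJaffe1985, (1.2) p.300] -/
theorem selfInt_eq_higgsP (lamε μsq : ℝ) (ξ : ℂ) :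
    selfInt lamε μsq ξ = higgsP lamε ((μsq - 1) / 2) ξ - 1 / (64 * lamε) := by
  unfold selfInt higgsP
  ring

/-- **THE BRIDGE (1.1) = [BalabanImbrieJaffe1988] (3.3) at the unit lattice**: C1's action `S(u, φ)` with couplings `e(ε)`, `λ(ε)`,
`μ² = (m² + δm²)ε²` and constant `E` equals C2's `action w c e λ δm² E₀ E₁` at `w = c = 1`, `e = e(ε)`, `λ = λ(ε)`, `δm² = (μ² − 1)/2`,
`E₀ = E − |T|/(64λ(ε))`, `E₁ = 0`, evaluated on the `ℂ`-valued bond field `b ↦ u_b`. [cite: BalabanImbrieJaffe1985, (1.1) p.300] -/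
theorem action_eq_action88 (eε lamε μsq E : ℝ) (u : U1Field P j) (φ : HiggsField P j) :
    BIJ85Sect1Model.action eε lamε μsq E u φ =
      BIJ88Sect3Statements.action 1 1 eε lamε ((μsq - 1) / 2) (E - Fintype.card (Balaban1983to89.Site P j) / (64 * lamε)) 0
        (fun b => (u b : ℂ)) φ := by
  have h1 : ∀ p : Balaban1983to89.Plaq P j, eε⁻¹ ^ 2 * (1 - ((plaq u p : Circle) : ℂ).re) =
      1 * (1 ^ 4 / eε ^ 2) * (1 - (plaqVar (fun b => (u b : ℂ)) p).re) := by
    intro p; rw [plaq_coe, inv_pow, one_pow, one_mul, one_div]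
  have h2 : ∀ b : PBond P j, ‖covDeriv u φ b‖ ^ 2 = 1 * ‖covD 1 (fun b => (u b : ℂ)) φ b‖ ^ 2 := by
    intro b; rw [covDeriv_eq_covD, one_mul]
  have h3 : ∑ x : Balaban1983to89.Site P j, selfInt lamε μsq (φ x) =
      (∑ x : Balaban1983to89.Site P j, 1 * higgsP lamε ((μsq - 1) / 2) (φ x)) - Fintype.card (Balaban1983to89.Site P j) / (64 * lamε) := by
    simp_rw [selfInt_eq_higgsP, one_mul, Finset.sum_sub_distrib, Finset.sum_const, Finset.card_univ, nsmul_eq_mul]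
    ring
  unfold BIJ85Sect1Model.action BIJ88Sect3Statements.action
  rw [Finset.sum_congr rfl fun p _ => h1 p, Finset.sum_congr rfl fun b _ => h2 b, h3]
  ring

/-- The bridge on the carrier of record: C1's (1.1) evaluated on the read field `toU1Field U` is C2's `actionU1 1 1 …` at `U`.
[cite: BalabanImbrieJaffe1985, (1.1) p.300] -/
theorem action_toU1Field (eε lamε μsq E : ℝ) (U : GaugeField P j U1) (φ : HiggsField P j) :
    BIJ85Sect1Model.action eε lamε μsq E (toU1Field U) φ =
      actionU1 1 1 eε lamε ((μsq - 1) / 2) (E - Fintype.card (Balaban1983to89.Site P j) / (64 * lamε)) 0 U φ := by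
  rw [action_eq_action88, coe_toU1Field_eq_cfg]
  rfl

/-! ## §2 The display (1.4) -/

/-- The unit-lattice action (1.1) `S(u, φ)` as a function of the configuration of record `(U, φ)` (the weight `e^{−S}` of (1.4)).
[cite: BalabanImbrieJaffe1985, (1.4) p.301] -/
def S11 (eε lamε μsq E : ℝ) (U : GaugeField P j U1) (φ : HiggsField P j) : ℝ :=
  BIJ85Sect1Model.action eε lamε μsq E (toU1Field U) φ

/-- kernel: `S11 = actionU1 1 1 e(ε) λ(ε) ((μ²−1)/2) (E − |T|/(64λ(ε))) 0` (the bridge, as functions). [cite: BalabanImbrieJaffe1985, (1.4) p.301] -/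
theorem S11_eq_actionU1 (eε lamε μsq E : ℝ) :
    S11 (P := P) (j := j) eε lamε μsq E =
      actionU1 1 1 eε lamε ((μsq - 1) / 2) (E - Fintype.card (Balaban1983to89.Site P j) / (64 * lamε)) 0 := by
  funext U φ
  exact action_toU1Field eε lamε μsq E U φ

/-- kernel: the same with the unit weights spelled `ε^d`, `ε⁻¹` at `ε = 1` (the shape of r18's well-definedness theorems).
[cite: BalabanImbrieJaffe1985, (1.4) p.301] -/
theorem S11_eq_actionU1_one (eε lamε μsq E : ℝ) :
    S11 (P := P) (j := j) eε lamε μsq E =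
      actionU1 ((1 : ℝ) ^ P.d) (1 : ℝ)⁻¹ eε lamε ((μsq - 1) / 2) (E - Fintype.card (Balaban1983to89.Site P j) / (64 * lamε)) 0 := by
  rw [one_pow, inv_one]
  exact S11_eq_actionU1 eε lamε μsq E

/-- **(1.4)** p. 301 [PDF 3], verbatim: *"We develop a method of steepest descent to study integrals of the form ∫ψe^{−S(u,φ)} / ∫e^{−S(u,φ)},
(1.4) where ψ is a gauge invariant functional of u and φ."* — the normalized integral of a functional `ψ(u, φ)` of C1's fields against the weight
`e^{−S}`, `S` = (1.1) with couplings `e(ε)`, `λ(ε)`, `μ² = (m² + δm²)ε²`, `E`; `𝒟u` = product Haar probability measure on `U(1)^{bonds}`, `𝒟φ` =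
Lebesgue measure on `ℂ^{sites}` of the periodic unit lattice; by definition the companion paper's `⟨·⟩ = [·]/[1]` (`BIJ88Sect3Statements.expect`)
at this action. [cite: BalabanImbrieJaffe1985, (1.4) p.301] -/
def integral14 (eε lamε μsq E : ℝ) (ψ : U1Field P j → HiggsField P j → ℂ) : ℂ :=
  expect (S11 eε lamε μsq E) fun U φ => ψ (toU1Field U) φ

/-- **(1.4) as printed**: `integral14 … ψ = (∫𝒟u ∫𝒟φ e^{−S(u,φ)}ψ(u,φ)) / (∫𝒟u ∫𝒟φ e^{−S(u,φ)})`. [cite: BalabanImbrieJaffe1985, (1.4) p.301] -/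
theorem integral14_eq_div (eε lamε μsq E : ℝ) (ψ : U1Field P j → HiggsField P j → ℂ) :
    integral14 eε lamε μsq E ψ =
      (∫ U, (∫ φ : HiggsField P j, (Real.exp (-(BIJ85Sect1Model.action eε lamε μsq E (toU1Field U) φ)) : ℂ) * ψ (toU1Field U) φ)
          ∂(fieldMeasure P j U1)) /
        ∫ U, (∫ φ : HiggsField P j, (Real.exp (-(BIJ85Sect1Model.action eε lamε μsq E (toU1Field U) φ)) : ℂ))
          ∂(fieldMeasure P j U1) := by
  unfold integral14 expect bracket S11
  simp only [mul_one]

/-- (1.4) is [BalabanImbrieJaffe1988]'s `⟨·⟩` (1.3)/(3.2) at the re-labelled couplings of the bridge `action_eq_action88`.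
[cite: BalabanImbrieJaffe1985, (1.4) p.301] -/
theorem integral14_eq_expect88 (eε lamε μsq E : ℝ) (ψ : U1Field P j → HiggsField P j → ℂ) :
    integral14 eε lamε μsq E ψ =
      expect (actionU1 1 1 eε lamε ((μsq - 1) / 2) (E - Fintype.card (Balaban1983to89.Site P j) / (64 * lamε)) 0)
        fun U φ => ψ (toU1Field U) φ := by
  unfold integral14
  rw [S11_eq_actionU1]

/-! ## §3 Well-definedness: the denominator of (1.4) is a positive real number -/

/-- **The denominator of (1.4) does not vanish**: `∫e^{−S(u,φ)}𝒟u𝒟φ ≠ 0` for every torus, every `λ(ε) > 0` and all `e(ε)`, `μ²`, `E` — so the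
typed quotient is the printed one, not Lean's junk value `x/0 = 0` (r18's `bracket_one_ne_zero` at `ε = 1` through the bridge).
[cite: BalabanImbrieJaffe1985, (1.4) p.301] -/
theorem den_ne_zero (eε : ℝ) {lamε : ℝ} (hlam : 0 < lamε) (μsq E : ℝ) :
    bracket (P := P) (j := j) (S11 eε lamε μsq E) (fun _ _ => (1 : ℂ)) ≠ 0 := by
  rw [S11_eq_actionU1_one]
  exact bracket_one_ne_zero one_pos eε hlam _ _ _

/-- The denominator of (1.4) has positive real part (the partition function is `> 0`). [cite: BalabanImbrieJaffe1985, (1.4) p.301] -/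
theorem re_den_pos (eε : ℝ) {lamε : ℝ} (hlam : 0 < lamε) (μsq E : ℝ) :
    0 < (bracket (P := P) (j := j) (S11 eε lamε μsq E) (fun _ _ => (1 : ℂ))).re := by
  rw [S11_eq_actionU1_one]
  exact re_bracket_one_pos one_pos eε hlam _ _ _

/-- The denominator of (1.4) is real. [cite: BalabanImbrieJaffe1985, (1.4) p.301] -/
theorem im_den (eε : ℝ) {lamε : ℝ} (hlam : 0 < lamε) (μsq E : ℝ) :
    (bracket (P := P) (j := j) (S11 eε lamε μsq E) (fun _ _ => (1 : ℂ))).im = 0 := by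
  rw [S11_eq_actionU1_one]
  exact im_bracket_one one_pos eε hlam _ _ _

/-- **`ψ ≡ 1` integrates to `1`** in (1.4), for `λ(ε) > 0`. [cite: BalabanImbrieJaffe1985, (1.4) p.301] -/
theorem integral14_one (eε : ℝ) {lamε : ℝ} (hlam : 0 < lamε) (μsq E : ℝ) :
    integral14 (P := P) (j := j) eε lamε μsq E (fun _ _ => (1 : ℂ)) = 1 := by
  unfold integral14
  rw [S11_eq_actionU1_one]
  exact expect_one one_pos eε hlam _ _ _

/-- (1.4) of a constant functional is the constant, for `λ(ε) > 0`. [cite: BalabanImbrieJaffe1985, (1.4) p.301] -/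
theorem integral14_const (eε : ℝ) {lamε : ℝ} (hlam : 0 < lamε) (μsq E : ℝ) (c : ℂ) :
    integral14 (P := P) (j := j) eε lamε μsq E (fun _ _ => c) = c := by
  unfold integral14
  rw [S11_eq_actionU1_one]
  exact expect_const one_pos eε hlam _ _ _ c

/-! ## §4 «where ψ is a gauge invariant functional of u and φ» -/

/-- *"ψ is a gauge invariant functional of u and φ"* (p. 301): `ψ(u^h, φ^h) = ψ(u, φ)` for every gauge transformation `h : T → U(1)` acting by
(2.7) p. 303 (`BIJ85Sect1Model.gaugeU`, `gaugeHiggs`). [cite: BalabanImbrieJaffe1985, (1.4) p.301] -/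
def GaugeInvariant {α : Type*} (ψ : U1Field P j → HiggsField P j → α) : Prop :=
  ∀ (h : Balaban1983to89.Site P j → Circle) (u : U1Field P j) (φ : HiggsField P j), ψ (gaugeU h u) (gaugeHiggs h φ) = ψ u φ

/-- The weight `e^{−S(u,φ)}` of (1.4) is a gauge invariant functional (r15's `action_gauge` for (1.1)). [cite: BalabanImbrieJaffe1985, (1.4) p.301] -/
theorem gaugeInvariant_boltzmann (eε lamε μsq E : ℝ) :
    GaugeInvariant (P := P) (j := j) fun u φ => Real.exp (-(BIJ85Sect1Model.action eε lamε μsq E u φ)) := by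
  intro h u φ
  simp only [BIJ85Sect1Model.action_gauge]

/-- kernel: the tree's gauge action `U ↦ U^g` (`GaugeField.gaugeAct`, `U^g_b = g(b₋)U_bg(b₊)⁻¹`) read through `toU1Field` is C1's (2.7)
`u ↦ u^h` with `h = circleEquivU1⁻¹ ∘ g` (abelian group). [cite: BalabanImbrieJaffe1985, (2.7) p.303] -/
theorem toU1Field_gaugeAct (g : GaugeTransf P j U1) (U : GaugeField P j U1) :
    toU1Field (GaugeField.gaugeAct g U) = gaugeU (fun x => circleEquivU1.symm (g x)) (toU1Field U) := by
  funext b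
  simp only [toU1Field, GaugeField.gaugeAct, gaugeU, map_mul, map_inv]
  rw [mul_right_comm]

/-- kernel: C1's (2.7) `φ ↦ φ^h` with `h = circleEquivU1⁻¹ ∘ g` is r18's `φ ↦ (x ↦ toC (g x) φ(x))`. [cite: BalabanImbrieJaffe1985, (2.7) p.303] -/
theorem gaugeHiggs_eq (g : GaugeTransf P j U1) (φ : HiggsField P j) :
    gaugeHiggs (fun x => circleEquivU1.symm (g x)) φ = fun x => toC (g x) * φ x := by
  funext x
  simp only [gaugeHiggs, coe_circleEquivU1_symm]

/-- **`⟨ψ^h⟩ = ⟨ψ⟩` in (1.4) for EVERY functional `ψ`** (gauge invariant or not) and every gauge transformation `h : T → U(1)`, where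
`ψ^h(u, φ) = ψ(u^h, φ^h)` by (2.7): both measures and the weight `e^{−S}` are gauge invariant (r18's `expect_gaugeAct` through the bridge) — so the
print's restriction of (1.4) to gauge invariant `ψ` loses no expectation value. [cite: BalabanImbrieJaffe1985, (1.4) p.301] -/
theorem integral14_gauge (eε lamε μsq E : ℝ) (h : Balaban1983to89.Site P j → Circle) (ψ : U1Field P j → HiggsField P j → ℂ) :
    integral14 eε lamε μsq E (fun u φ => ψ (gaugeU h u) (gaugeHiggs h φ)) = integral14 eε lamε μsq E ψ := by
  unfold integral14
  rw [S11_eq_actionU1]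
  have key := expect_gaugeAct (P := P) (j := j) 1 1 eε lamε ((μsq - 1) / 2)
    (E - Fintype.card (Balaban1983to89.Site P j) / (64 * lamε)) 0 (fun x => circleEquivU1 (h x)) fun U φ => ψ (toU1Field U) φ
  have hh : (fun x => circleEquivU1.symm (circleEquivU1 (h x))) = h := by
    funext x; exact circleEquivU1.symm_apply_apply (h x)
  have hU : ∀ U : GaugeField P j U1, toU1Field (GaugeField.gaugeAct (fun x => circleEquivU1 (h x)) U) = gaugeU h (toU1Field U) := by
    intro U; rw [toU1Field_gaugeAct, hh]
  have hφ : ∀ φ : HiggsField P j, (fun x => toC (circleEquivU1 (h x)) * φ x) = gaugeHiggs h φ := by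
    intro φ; rw [← gaugeHiggs_eq, hh]
  simp only [hU, hφ] at key
  exact key

/-- For a GAUGE INVARIANT `ψ` the integrand of (1.4) is itself invariant: `ψ^h = ψ` (so `integral14_gauge` is then a tautology — the content
of the theorem is for general `ψ`). [cite: BalabanImbrieJaffe1985, (1.4) p.301] -/
theorem GaugeInvariant.comp_gauge {ψ : U1Field P j → HiggsField P j → ℂ} (hψ : GaugeInvariant ψ) (h : Balaban1983to89.Site P j → Circle) :
    (fun u φ => ψ (gaugeU h u) (gaugeHiggs h φ)) = ψ := by
  funext u φ
  exact hψ h u φ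

end

end Literature.MathematicalPhysics.QuantumFieldTheory.BalabanImbrieJaffe1984to88.BIJ85Integral14
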